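/-
Copyright (c) 2026 the pub-hodgecm-mathlib formalisation cell (harness21).  Prover seat hodgecm-mathlib-K2Liu-p13 (g3), Track B «K2-LIT»,
#184♮ = hLiu418 = `stmt-HodgeConjecture-24832`; ROAD Φ (RULING «M-156n»), consumer sheet fa2b1e3a29709f09 row G6-fin «Φ8 FACE PACKAGING»
(LEAD F0P6-plan (g14) BATCH #30, 2026-09-04T14:14:17Z); census `K2/K2Liu-p13/g3/CENSUS-G6fin-Phi8FacePackaging.K2Liu-p13-g3.md` 065e2d080ef468d9.
THEOREMS ONLY (no `def`, no `instance`, no named-fact hypothesis, no `sorry`); hypothesis-first (every face BY VALUE); Mathlib + ★ Vitali only.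
-/
import Summits.HodgeConjecture.HodgeConjecture.Theorems.K2LiuContinuityFromHalfPlane
import Mathlib.Analysis.SpecialFunctions.Pow.Real
import HarnessLib

/-!
# Crux `HLiu418`, ROAD Φ, organ Φ8 (sheet row G6-fin): THE BIG CELL OF THE CONSTANT TERM AS A (P,E⋆)-TERM PACKAGE — FROM ITS FACES

Cell `hodgecm-mathlib`, crux item hLiu418 = `stmt-HodgeConjecture-24832` (helper lane, count-neutral).  The `S = 0` Fourier coefficient of the doubled
Siegel Eisenstein series `E^Δ(h; f_s)` is its constant term `(∫β)·f_s(h) + M(s)f_s(h) + MID(s,h)` (★ O41.4 `K2LiuConstantTermDelta.constTerm_three_cells`);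
the BIG CELL is the Siegel intertwining integral `M(s)f_s(h) = ∫_{N_Δ(𝔸)} f_s(w_Δ u h) du` (★ D9 `intertwiningDelta`, absolutely convergent for `re s > n∕2`,
★ O41.3).  For a standard (factorizable) section it is EULERIAN (★ Φ3d `whittakerDelta_eq_mul_tprod` at `S = 0`, ★ `whittakerDelta_zero_index`):
`M(s)f_s(h) = r(s) · M⋆(s,h)` with
* the SCALAR FACE `r = a^S∕b^S` — the Gindikin–Karpelevich ratio of partial Hecke `L`-functions of `L⁺` (`a = ζ_{L⁺}(2s)L(2s−1,ε)`, `b = ζ_{L⁺}(2s+1)L(2s+2,ε)`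
  under the parity `χ⁰ = ε` of the K2_Liu frame), continued by ★ Φ8-scalar `K2LiuSiegelIntertwiningScalarGL1.exists_differentiableOn_sub_half_mul_scalar_cm`:
  `(s − ½)·r(s) = G(s)` on `1 < re s` with `G` HOLOMORPHIC on `{0 < re}` — i.e. a pole set `P = {½}` and a pole-cleared scalar `G`;
* the NORMALISED FACE `M⋆(s,h)` — the product of the normalised local operators at the finitely many bad places (finite places: ★ A7-reg
  `K2LiuA7NormalisedRegularity{,Split,Nonsplit,CM}`, `M_v(s)f_v = aNorm_v(s)·Fn_v(s,·)` with `Fn_v` rational in `q_v^{−s}`; archimedean places: the A∞ organ,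
  sheet row G6-arch) and the values of the section off them: HOLOMORPHIC on `{0 < re}` in `s` for every `h`, of locally uniform moderate growth `‖M⋆(s,h)‖ ≤ C‖h‖^A`.
THIS FILE (abstract `X` in place of `H(𝔸)`, any height `X → ℝ_{>0}` bounded on compacts, any convergence abscissa `c ≥ 0`) PACKAGES the two faces, taken BY VALUE, into a
TERM PACKAGE in the exact currency of ★ Φ9 `K2LiuSiegelEisensteinAssembly.exists_continuation_package_of_term_packages` (its `Ec i`, clauses `hd`∕`hc`∕`heq`-shape∕`hgrowth`-shape):
**`exists_bigCell_package`** `: ∃ E₈, (i) s ↦ E₈ s x holomorphic on {0 < re} ∧ (ii) E₈ s continuous for 0 < re s ∧ (iv) E₈ s x = (∏_{p∈P}(s − p))·BIG s x for c < re s ∧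
(v) ‖E₈ s x‖ ≤ C·height x^A locally uniformly in s` — with `E₈ := G · M⋆`; (ii) is obtained by ★ `K2LiuContinuityFromHalfPlane.continuous_of_differentiableOn_halfPlane`
(Vitali) from (i), (v) and the continuity of the CONVERGENT big cell `BIG(s, ·)` on `c < re s`, so NO continuity of the normalised face off the convergence
half-plane is asked (the Iwasawa-dependent local brackets `Fn_v(s, ·)` are not known to be continuous there).  Variants: `exists_bigCell_package_of_continuous`
(continuity of `M⋆(s,·)` by value instead, no compactness bookkeeping) and **`exists_bigCell_package₃`** — THREE faces `BIG = r · A · Φ` with the archimedean face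
carrying ITS OWN package `(P_∞, G_∞)` (sheet row G6-arch ∕ LEAD σ20: per-`K_∞`-type meromorphic package) and `P₈ = P ∪ P_∞` for DISJOINT pole sets (the `Finset`
currency of socket #41 records simple poles only: coincident poles of the scalar and archimedean faces are outside it, and are not claimed).
WHICH `S` (census (F1)): the scalar face must be instantiated at a set `S` of finite places off which `ε` is unramified AND containing no level place of `f` where
`χ_F` is unramified beyond those folded into `r` — e.g. `S := T_χ` (ramified places of `χ⁰`), the local ratios `a_v∕b_v` at the other bad places being part of `r`,
NOT of `M⋆` (they have poles on `re s = ½`); this file is agnostic (abstract `r`).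
Sources: [MoeglinWaldspurger1995, II.1.6–II.1.7 (constant terms, `M(s) = ⊗_v M_v(s)`), IV.1.9–IV.1.11]; [Tan1999, §2–§3, §4 Prop. 4.8]; [KudlaSweet1997, §1];
[HarrisKudlaSweet1996, §6 (6.14)–(6.16)]; [KudlaRallis1994, §1 Thm. 1.1].
HONEST LABEL.  Helper lemmas, count-neutral; `HC_CM` is proved only modulo the 7 printed citations (2 remaining named inputs:
hLiu418 = `stmt-HodgeConjecture-24832`, h413 = `stmt-HodgeConjecture-24833`) until rung 0 closes.
-/

set_option autoImplicit false
set_option linter.dupNamespace false -- the mandated namespace repeats `HodgeConjecture.HodgeConjecture`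

noncomputable section

namespace Summit.HodgeConjecture.HodgeConjecture.Cruxes.HLiu418.K2LiuBigCellPackageOfFaces

open Set Filter Topology Metric Complex
open scoped BigOperators
open K2LiuContinuityFromHalfPlane

variable {X : Type*} [TopologicalSpace X] [FirstCountableTopology X]

/-! ## §1 Elementary: a holomorphic scalar is bounded near every point of the open half-plane -/

omit [TopologicalSpace X] [FirstCountableTopology X] in
/-- A function holomorphic on `{0 < re}` is bounded on a small disc round each `z` with `0 < re z` (continuity at an interior point). [folklore] -/
theorem exists_ball_norm_le_of_differentiableOn {G : ℂ → ℂ} (hG : DifferentiableOn ℂ G {s : ℂ | 0 < s.re}) {z : ℂ} (hz : 0 < z.re) :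
    ∃ ρ : ℝ, 0 < ρ ∧ ∀ s : ℂ, dist s z < ρ → ‖G s‖ ≤ ‖G z‖ + 1 := by
  have hopen : IsOpen {s : ℂ | 0 < s.re} := isOpen_lt continuous_const Complex.continuous_re
  have hcont : ContinuousAt G z := (hG.continuousOn.continuousWithinAt hz).continuousAt (hopen.mem_nhds hz)
  obtain ⟨ρ, hρ, hd⟩ := Metric.continuousAt_iff.1 hcont 1 one_pos
  refine ⟨ρ, hρ, fun s hs => ?_⟩
  have h1 : dist (G s) (G z) < 1 := hd hs
  rw [dist_eq_norm] at h1
  calc ‖G s‖ = ‖G z + (G s - G z)‖ := by rw [add_sub_cancel]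
    _ ≤ ‖G z‖ + ‖G s - G z‖ := norm_add_le _ _
    _ ≤ ‖G z‖ + 1 := by linarith

/-! ## §2 Two faces: `BIG = r · M⋆` on the convergence half-plane -/

/-- **Φ8 FACE PACKAGING — THE BIG CELL AS A TERM PACKAGE WITH THE POLE SET OF ITS SCALAR FACE.**  DATA (by value): a height `height : X → ℝ` (positive,
bounded on compacts); a SCALAR FACE `r : ℂ → ℂ` with a finite `P ⊂ ℂ` and `G : ℂ → ℂ` holomorphic on `{0 < re}` such that `(∏_{p∈P}(s − p))·r s = G s` for
`c < re s` (★ Φ8-scalar: `P = {½}`); a NORMALISED FACE `Mstar : ℂ → X → ℂ`, holomorphic on `{0 < re}` in `s` for every `x`, with `‖Mstar s x‖ ≤ C·height x^A`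
near every `z` (`0 < re z`); and the BIG CELL `BIG : ℂ → X → ℂ`, continuous in `x` and EQUAL to `r s · Mstar s x` for `c < re s` (`0 ≤ c`; the Euler
factorisation ★ Φ3d at `S = 0`).  THEN there is `E₈ : ℂ → X → ℂ` with (i) `s ↦ E₈ s x` holomorphic on `{0 < re}`, (ii) `E₈ s` continuous for `0 < re s`
(Vitali ★ `continuous_of_differentiableOn_halfPlane`), (iv) `E₈ s x = (∏_{p∈P}(s − p))·BIG s x` for `c < re s`, (v) `‖E₈ s x‖ ≤ C·height x^A` locally
uniformly in `s` — the (P,E⋆)-package of the big cell in the currency of ★ Φ9 `exists_continuation_package_of_term_packages`.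
[cite: MoeglinWaldspurger1995, II.1.7, IV.1.9] [cite: Tan1999, §4 Prop. 4.8] [cite: KudlaSweet1997, §1] -/
theorem exists_bigCell_package
    (height : X → ℝ) (hpos : ∀ x, 0 < height x) (hcpt : ∀ K : Set X, IsCompact K → ∃ B : ℝ, ∀ x ∈ K, height x ≤ B)
    (P : Finset ℂ) (r G : ℂ → ℂ) (hG : DifferentiableOn ℂ G {s : ℂ | 0 < s.re})
    {c : ℝ} (hc : 0 ≤ c) (hrG : ∀ s : ℂ, c < s.re → (∏ p ∈ P, (s - p)) * r s = G s)
    (Mstar : ℂ → X → ℂ) (hMd : ∀ x, DifferentiableOn ℂ (fun s => Mstar s x) {s : ℂ | 0 < s.re})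
    (hMg : ∀ z : ℂ, 0 < z.re → ∃ C A ρ : ℝ, 0 ≤ C ∧ 0 ≤ A ∧ 0 < ρ ∧ ∀ s : ℂ, dist s z < ρ → ∀ x, ‖Mstar s x‖ ≤ C * height x ^ A)
    (BIG : ℂ → X → ℂ) (hBc : ∀ s : ℂ, c < s.re → Continuous (BIG s))
    (hB : ∀ (s : ℂ) (x : X), c < s.re → BIG s x = r s * Mstar s x) :
    ∃ E₈ : ℂ → X → ℂ,
      (∀ x, DifferentiableOn ℂ (fun s => E₈ s x) {s : ℂ | 0 < s.re}) ∧
      (∀ s : ℂ, 0 < s.re → Continuous (E₈ s)) ∧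
      (∀ (s : ℂ) (x : X), c < s.re → E₈ s x = (∏ p ∈ P, (s - p)) * BIG s x) ∧
      (∀ z : ℂ, 0 < z.re → ∃ C A ρ : ℝ, 0 < ρ ∧ ∀ s : ℂ, dist s z < ρ → ∀ x, ‖E₈ s x‖ ≤ C * height x ^ A) := by
  -- the package
  set E₈ : ℂ → X → ℂ := fun s x => G s * Mstar s x with hE₈
  -- (i) holomorphy on `{0 < re}`
  have hd : ∀ x, DifferentiableOn ℂ (fun s => E₈ s x) {s : ℂ | 0 < s.re} := fun x => hG.mul (hMd x)
  -- (iv) agreement on `c < re s`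
  have heq : ∀ (s : ℂ) (x : X), c < s.re → E₈ s x = (∏ p ∈ P, (s - p)) * BIG s x := by
    intro s x hs
    simp only [hE₈]
    rw [hB s x hs, ← hrG s hs, mul_assoc]
  -- (v) growth, with signs recorded
  have hgrowth : ∀ z : ℂ, 0 < z.re → ∃ C A ρ : ℝ, 0 ≤ C ∧ 0 ≤ A ∧ 0 < ρ ∧ ∀ s : ℂ, dist s z < ρ → ∀ x, ‖E₈ s x‖ ≤ C * height x ^ A := by
    intro z hz
    obtain ⟨CM, AM, ρM, hCM, hAM, hρM, hM⟩ := hMg z hz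
    obtain ⟨ρG, hρG, hGb⟩ := exists_ball_norm_le_of_differentiableOn hG hz
    refine ⟨(‖G z‖ + 1) * CM, AM, min ρM ρG, by positivity, hAM, lt_min hρM hρG, fun s hs x => ?_⟩
    have hsM : dist s z < ρM := lt_of_lt_of_le hs (min_le_left _ _)
    have hsG : dist s z < ρG := lt_of_lt_of_le hs (min_le_right _ _)
    calc ‖E₈ s x‖ = ‖G s‖ * ‖Mstar s x‖ := norm_mul _ _
      _ ≤ (‖G z‖ + 1) * (CM * height x ^ AM) :=
          mul_le_mul (hGb s hsG) (hM s hsM x) (norm_nonneg _) (by positivity)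
      _ = (‖G z‖ + 1) * CM * height x ^ AM := by ring
  -- (ii) continuity, by Vitali from (i), (v) and the continuity of `BIG` on the convergence half-plane
  have hcont : ∀ s : ℂ, 0 < s.re → Continuous (E₈ s) := by
    intro s hs
    refine continuous_of_differentiableOn_halfPlane (a := 0) (c := c) hc E₈ hd (fun K hK z hz => ?_) (fun s' hs' => ?_) hs
    · obtain ⟨C, A, ρ, hC, hA, hρ, hle⟩ := hgrowth z hz
      obtain ⟨B, hB⟩ := hcpt K hK
      refine ⟨C * max B 1 ^ A, ρ, hρ, fun s' hs' x hx => (hle s' (mem_ball.1 hs') x).trans ?_⟩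
      exact mul_le_mul_of_nonneg_left (Real.rpow_le_rpow (hpos x).le ((hB x hx).trans (le_max_left _ _)) hA) hC
    · have h : Continuous fun x => (∏ p ∈ P, (s' - p)) * BIG s' x := continuous_const.mul (hBc s' hs')
      exact h.congr fun x => (heq s' x hs').symm
  exact ⟨E₈, hd, hcont, heq, fun z hz => by
    obtain ⟨C, A, ρ, _, _, hρ, hle⟩ := hgrowth z hz
    exact ⟨C, A, ρ, hρ, hle⟩⟩

omit [FirstCountableTopology X] in
/-- **Φ8 FACE PACKAGING, continuity of the normalised face BY VALUE.**  Same as `exists_bigCell_package`, but clause (ii) is read off the continuity of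
`Mstar s` for every `0 < re s` (when the normalised face is delivered in the compact picture, as a finite combination of explicit flat sections) instead
of Vitali — no compactness bookkeeping of the height and no continuity of `BIG` are needed. [cite: MoeglinWaldspurger1995, II.1.7, IV.1.9] [cite: Tan1999, §4 Prop. 4.8] -/
theorem exists_bigCell_package_of_continuous
    (height : X → ℝ) (P : Finset ℂ) (r G : ℂ → ℂ) (hG : DifferentiableOn ℂ G {s : ℂ | 0 < s.re})
    {c : ℝ} (hrG : ∀ s : ℂ, c < s.re → (∏ p ∈ P, (s - p)) * r s = G s)
    (Mstar : ℂ → X → ℂ) (hMd : ∀ x, DifferentiableOn ℂ (fun s => Mstar s x) {s : ℂ | 0 < s.re})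
    (hMc : ∀ s : ℂ, 0 < s.re → Continuous (Mstar s))
    (hMg : ∀ z : ℂ, 0 < z.re → ∃ C A ρ : ℝ, 0 ≤ C ∧ 0 < ρ ∧ ∀ s : ℂ, dist s z < ρ → ∀ x, ‖Mstar s x‖ ≤ C * height x ^ A)
    (BIG : ℂ → X → ℂ) (hB : ∀ (s : ℂ) (x : X), c < s.re → BIG s x = r s * Mstar s x) :
    ∃ E₈ : ℂ → X → ℂ,
      (∀ x, DifferentiableOn ℂ (fun s => E₈ s x) {s : ℂ | 0 < s.re}) ∧
      (∀ s : ℂ, 0 < s.re → Continuous (E₈ s)) ∧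
      (∀ (s : ℂ) (x : X), c < s.re → E₈ s x = (∏ p ∈ P, (s - p)) * BIG s x) ∧
      (∀ z : ℂ, 0 < z.re → ∃ C A ρ : ℝ, 0 < ρ ∧ ∀ s : ℂ, dist s z < ρ → ∀ x, ‖E₈ s x‖ ≤ C * height x ^ A) := by
  set E₈ : ℂ → X → ℂ := fun s x => G s * Mstar s x with hE₈
  have hopen : IsOpen {s : ℂ | 0 < s.re} := isOpen_lt continuous_const Complex.continuous_re
  refine ⟨E₈, fun x => hG.mul (hMd x), fun s hs => continuous_const.mul (hMc s hs), fun s x hs => ?_, fun z hz => ?_⟩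
  · simp only [hE₈]
    rw [hB s x hs, ← hrG s hs, mul_assoc]
  · obtain ⟨CM, AM, ρM, hCM, hρM, hM⟩ := hMg z hz
    obtain ⟨ρG, hρG, hGb⟩ := exists_ball_norm_le_of_differentiableOn hG hz
    refine ⟨(‖G z‖ + 1) * CM, AM, min ρM ρG, lt_min hρM hρG, fun s hs x => ?_⟩
    have hsM : dist s z < ρM := lt_of_lt_of_le hs (min_le_left _ _)
    have hsG : dist s z < ρG := lt_of_lt_of_le hs (min_le_right _ _)
    calc ‖E₈ s x‖ = ‖G s‖ * ‖Mstar s x‖ := norm_mul _ _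
      _ ≤ (‖G z‖ + 1) * (CM * height x ^ AM) :=
          mul_le_mul (hGb s hsG) (hM s hsM x) (norm_nonneg _) (by positivity)
      _ = (‖G z‖ + 1) * CM * height x ^ AM := by ring

/-! ## §3 Three faces: `BIG = r · A · Φ` — scalar, archimedean package, finite normalised part -/

omit [TopologicalSpace X] [FirstCountableTopology X] in
/-- disjoint pole sets re-clear jointly: `(∏_{P₁}(s−p))·(∏_{P₂}(s−p)) = ∏_{P₁ ∪ P₂}(s−p)` for `Disjoint P₁ P₂`. [folklore] -/
theorem prod_sub_mul_prod_sub_of_disjoint {P₁ P₂ : Finset ℂ} (h : Disjoint P₁ P₂) (s : ℂ) :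
    (∏ p ∈ P₁, (s - p)) * ∏ p ∈ P₂, (s - p) = ∏ p ∈ P₁ ∪ P₂, (s - p) :=
  (Finset.prod_union h).symm

/-- **Φ8 FACE PACKAGING WITH AN ARCHIMEDEAN PACKAGE — THREE FACES, POLE SET `P ∪ P_∞`.**  DATA (by value): height as before; the SCALAR FACE `(r, P, G)` as in
`exists_bigCell_package`; an ARCHIMEDEAN FACE `Ainf : ℂ → X → ℂ` delivered as ITS OWN package — a finite `Pinf ⊂ ℂ` DISJOINT from `P` and `Ginf : ℂ → X → ℂ`
holomorphic on `{0 < re}` in `s`, with `Ginf s x = (∏_{p∈Pinf}(s − p))·Ainf s x` for `c < re s` and `‖Ginf s x‖ ≤ C·height x^A` near every `z` (sheet row G6-arch,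
LEAD σ20: per-`K_∞`-type meromorphic package); a FINITE NORMALISED FACE `Φ : ℂ → X → ℂ` holomorphic on `{0 < re}` with `‖Φ s x‖ ≤ C·height x^A` near every `z`
(★ A7-reg brackets and spherical values); and `BIG s x = r s · Ainf s x · Φ s x` for `c < re s` with `BIG s` continuous there.  THEN the big cell has a
(P,E⋆)-package with pole set `P ∪ Pinf`: `E₈ := G · Ginf · Φ` satisfies (i), (ii) (Vitali), (iv) `E₈ s x = (∏_{p ∈ P ∪ Pinf}(s − p))·BIG s x` for `c < re s`, (v).
The `Finset` currency records SIMPLE poles: coincident poles of the scalar and archimedean faces are excluded by `Disjoint P Pinf` (not claimed).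
[cite: MoeglinWaldspurger1995, II.1.7, IV.1.9–IV.1.11] [cite: Tan1999, §4 Prop. 4.8] [cite: KudlaSweet1997, §1] -/
theorem exists_bigCell_package₃
    (height : X → ℝ) (hpos : ∀ x, 0 < height x) (hcpt : ∀ K : Set X, IsCompact K → ∃ B : ℝ, ∀ x ∈ K, height x ≤ B)
    (P : Finset ℂ) (r G : ℂ → ℂ) (hG : DifferentiableOn ℂ G {s : ℂ | 0 < s.re})
    {c : ℝ} (hc : 0 ≤ c) (hrG : ∀ s : ℂ, c < s.re → (∏ p ∈ P, (s - p)) * r s = G s)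
    (Pinf : Finset ℂ) (hdisj : Disjoint P Pinf) (Ainf Ginf : ℂ → X → ℂ)
    (hGinfd : ∀ x, DifferentiableOn ℂ (fun s => Ginf s x) {s : ℂ | 0 < s.re})
    (hGinfeq : ∀ (s : ℂ) (x : X), c < s.re → Ginf s x = (∏ p ∈ Pinf, (s - p)) * Ainf s x)
    (hGinfg : ∀ z : ℂ, 0 < z.re → ∃ C A ρ : ℝ, 0 ≤ C ∧ 0 ≤ A ∧ 0 < ρ ∧ ∀ s : ℂ, dist s z < ρ → ∀ x, ‖Ginf s x‖ ≤ C * height x ^ A)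
    (Φ : ℂ → X → ℂ) (hΦd : ∀ x, DifferentiableOn ℂ (fun s => Φ s x) {s : ℂ | 0 < s.re})
    (hΦg : ∀ z : ℂ, 0 < z.re → ∃ C A ρ : ℝ, 0 ≤ C ∧ 0 ≤ A ∧ 0 < ρ ∧ ∀ s : ℂ, dist s z < ρ → ∀ x, ‖Φ s x‖ ≤ C * height x ^ A)
    (BIG : ℂ → X → ℂ) (hBc : ∀ s : ℂ, c < s.re → Continuous (BIG s))
    (hB : ∀ (s : ℂ) (x : X), c < s.re → BIG s x = r s * Ainf s x * Φ s x) :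
    ∃ E₈ : ℂ → X → ℂ,
      (∀ x, DifferentiableOn ℂ (fun s => E₈ s x) {s : ℂ | 0 < s.re}) ∧
      (∀ s : ℂ, 0 < s.re → Continuous (E₈ s)) ∧
      (∀ (s : ℂ) (x : X), c < s.re → E₈ s x = (∏ p ∈ P ∪ Pinf, (s - p)) * BIG s x) ∧
      (∀ z : ℂ, 0 < z.re → ∃ C A ρ : ℝ, 0 < ρ ∧ ∀ s : ℂ, dist s z < ρ → ∀ x, ‖E₈ s x‖ ≤ C * height x ^ A) := by
  -- the normalised face of the two-face theorem is `Ginf · Φ`, against the re-cleared scalar `r' := r` read with pole set `P`; we run the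
  -- two-face argument directly on `E₈ := G · (Ginf · Φ)` to keep the pole set `P ∪ Pinf` explicit.
  set E₈ : ℂ → X → ℂ := fun s x => G s * (Ginf s x * Φ s x) with hE₈
  -- (i)
  have hd : ∀ x, DifferentiableOn ℂ (fun s => E₈ s x) {s : ℂ | 0 < s.re} := fun x => hG.mul ((hGinfd x).mul (hΦd x))
  -- (iv)
  have heq : ∀ (s : ℂ) (x : X), c < s.re → E₈ s x = (∏ p ∈ P ∪ Pinf, (s - p)) * BIG s x := by
    intro s x hs
    simp only [hE₈]
    rw [hB s x hs, hGinfeq s x hs, ← hrG s hs, ← prod_sub_mul_prod_sub_of_disjoint hdisj s]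
    ring
  -- (v) with signs
  have hgrowth : ∀ z : ℂ, 0 < z.re → ∃ C A ρ : ℝ, 0 ≤ C ∧ 0 ≤ A ∧ 0 < ρ ∧ ∀ s : ℂ, dist s z < ρ → ∀ x, ‖E₈ s x‖ ≤ C * height x ^ A := by
    intro z hz
    obtain ⟨C₁, A₁, ρ₁, hC₁, hA₁, hρ₁, h₁⟩ := hGinfg z hz
    obtain ⟨C₂, A₂, ρ₂, hC₂, hA₂, hρ₂, h₂⟩ := hΦg z hz
    obtain ⟨ρG, hρG, hGb⟩ := exists_ball_norm_le_of_differentiableOn hG hz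
    refine ⟨(‖G z‖ + 1) * (C₁ * C₂), A₁ + A₂, min (min ρ₁ ρ₂) ρG, by positivity, by positivity, lt_min (lt_min hρ₁ hρ₂) hρG,
      fun s hs x => ?_⟩
    have hs₁ : dist s z < ρ₁ := lt_of_lt_of_le hs ((min_le_left _ _).trans (min_le_left _ _))
    have hs₂ : dist s z < ρ₂ := lt_of_lt_of_le hs ((min_le_left _ _).trans (min_le_right _ _))
    have hsG : dist s z < ρG := lt_of_lt_of_le hs (min_le_right _ _)
    have hx := hpos x
    have hprod : ‖Ginf s x * Φ s x‖ ≤ C₁ * C₂ * height x ^ (A₁ + A₂) := by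
      calc ‖Ginf s x * Φ s x‖ = ‖Ginf s x‖ * ‖Φ s x‖ := norm_mul _ _
        _ ≤ (C₁ * height x ^ A₁) * (C₂ * height x ^ A₂) :=
            mul_le_mul (h₁ s hs₁ x) (h₂ s hs₂ x) (norm_nonneg _) (mul_nonneg hC₁ (Real.rpow_nonneg hx.le _))
        _ = C₁ * C₂ * (height x ^ A₁ * height x ^ A₂) := by ring
        _ = C₁ * C₂ * height x ^ (A₁ + A₂) := by rw [← Real.rpow_add hx]
    calc ‖E₈ s x‖ = ‖G s‖ * ‖Ginf s x * Φ s x‖ := norm_mul _ _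
      _ ≤ (‖G z‖ + 1) * (C₁ * C₂ * height x ^ (A₁ + A₂)) :=
          mul_le_mul (hGb s hsG) hprod (norm_nonneg _) (by positivity)
      _ = (‖G z‖ + 1) * (C₁ * C₂) * height x ^ (A₁ + A₂) := by ring
  -- (ii) Vitali
  have hcont : ∀ s : ℂ, 0 < s.re → Continuous (E₈ s) := by
    intro s hs
    refine continuous_of_differentiableOn_halfPlane (a := 0) (c := c) hc E₈ hd (fun K hK z hz => ?_) (fun s' hs' => ?_) hs
    · obtain ⟨C, A, ρ, hC, hA, hρ, hle⟩ := hgrowth z hz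
      obtain ⟨B, hB⟩ := hcpt K hK
      refine ⟨C * max B 1 ^ A, ρ, hρ, fun s' hs' x hx => (hle s' (mem_ball.1 hs') x).trans ?_⟩
      exact mul_le_mul_of_nonneg_left (Real.rpow_le_rpow (hpos x).le ((hB x hx).trans (le_max_left _ _)) hA) hC
    · have h : Continuous fun x => (∏ p ∈ P ∪ Pinf, (s' - p)) * BIG s' x := continuous_const.mul (hBc s' hs')
      exact h.congr fun x => (heq s' x hs').symm
  exact ⟨E₈, hd, hcont, heq, fun z hz => by
    obtain ⟨C, A, ρ, _, _, hρ, hle⟩ := hgrowth z hz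
    exact ⟨C, A, ρ, hρ, hle⟩⟩

end Summit.HodgeConjecture.HodgeConjecture.Cruxes.HLiu418.K2LiuBigCellPackageOfFaces

end
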